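import Mathlib

/-!
# Pancharatnam (Bargmann) product identity for a chain of rank-one projectors
(deq-2 / DEQ-A198 Prop. A198.1; CLAIMS row A-198, §1 OPEN-72; staged by deq-2 gen 30 as
pub-qadeq-deq-2/lean/PancharatnamProduct.lean and filed by the cell lead, harvest-1 gen 22, with the
pre-ruling labels ‘A-190 cand.’ / DEQ-A190 of the staging docstring replaced by the ruled ids — comments only;
revised by the lead, gen 23, per review of p290702: the ad-hoc `headOr` is replaced by core `List.headD`)

HONEST FRAMING: instance-level adjudication of specific advantage claims; no claim about
BQP vs BPP or the summit.

Setting.  R. Hayakawa, K. Sakamoto, C. Kiumi, *Computational complexity of Berry phase estimation in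
topological phases of matter*, arXiv:2509.13423v3 (2026), Definition 6 / Theorem 1 (CLAIMS row
A-198): Berry-phase estimation for a loop of gapped local Hamiltonians GIVEN a guiding state
`c` is BQP-complete at inverse-polynomial phase precision; the paper asks (its §1.3) whether the
constant-precision regime admits classical containment, remarking that a dequantization 'would need to
keep track of relative phases between eigenstates at different parameter values'.

Content (PROVED, elementary; an arbitrary complex inner-product space `E`, no normalisation assumed).
For vectors `ψ₀, ψ₁, …, ψ_{K-1}` write `rproj ψ v = ⟪ψ, v⟫ • ψ` (the orthogonal projector onto `ψ`
when `‖ψ‖ = 1`) and let `chain [ψ₁, …, ψ_{K-1}]` be the composite `rproj ψ₁ ∘ ⋯ ∘ rproj ψ_{K-1}`.  Then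

  `⟪c, (rproj ψ₀ ∘ chain [ψ₁,…,ψ_{K-1}] ∘ rproj ψ₀) c⟫ = ⟪ψ₀, c⟫ · conj ⟪ψ₀, c⟫ · ∏_{k=0}^{K-1} ⟪ψ_k, ψ_{k+1}⟫`

with `ψ_K := ψ₀` (`pancharatnam_product`; the cyclic product is `pairProd (ψ₀ :: t ++ [ψ₀])`).
So the guiding-state matrix element of the projector chain `Π₀ Π₁ ⋯ Π_{K-1} Π₀` equals
`|⟪ψ₀, c⟫|²` times the gauge-invariant Bargmann invariant of the loop of ground states, whose
argument is (minus) the discrete Berry phase: NO phase convention for the individual `ψ_k` enters,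
because each `ψ_k` occurs once as a bra and once as a ket.

Interpretation (DEQ-A198 §2, OURS, hedged; NOT a Lean claim): replacing each `Π_k` by a
constant-degree polynomial filter in `H(λ_k)` and estimating `⟪c, A c⟫` by sample-and-query
importance sampling (the Gharibian–Le Gall lemma) gives a classical estimator of the Berry phase
whose cost is polynomial when the phase precision, the overlap, and the gap RELATIVE to `Σ‖h_i‖`
are constants — a corner that excludes the paper's hard instances (relative gap `1/poly`).  Only the
algebraic identity is kernel-checked here.
-/

namespace Summit.QuantumAdvantage.Dequantization.PancharatnamProduct

open scoped ComplexConjugate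

variable {E : Type*} [NormedAddCommGroup E] [InnerProductSpace ℂ E]

local notation "⟪" x ", " y "⟫" => @inner ℂ E _ x y

/-- The rank-one map `v ↦ ⟪ψ, v⟫ • ψ` (the orthogonal projector onto `span {ψ}` when `‖ψ‖ = 1`). -/
noncomputable def rproj (ψ v : E) : E := ⟪ψ, v⟫ • ψ

/-- `chain [a, b, …, z] v = rproj a (rproj b (⋯ (rproj z v)))` — the operator product
`Π_a Π_b ⋯ Π_z` applied to `v` (rightmost factor acts first). -/
noncomputable def chain : List E → E → E
  | [], v => v
  | a :: t, v => rproj a (chain t v)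

/-- Product of inner products of consecutive entries: `pairProd [x₀, x₁, …, x_r] = ∏ ⟪x_i, x_{i+1}⟫`
(empty product `1` for lists of length ≤ 1). -/
noncomputable def pairProd : List E → ℂ
  | [] => 1
  | [_] => 1
  | x :: y :: r => ⟪x, y⟫ * pairProd (y :: r)

/-- The empty chain is the identity. -/
@[simp] lemma chain_nil (v : E) : chain [] v = v := rfl
/-- Unfolding the chain at its first projector. -/
@[simp] lemma chain_cons (a : E) (t : List E) (v : E) : chain (a :: t) v = rproj a (chain t v) := rfl
/-- Empty product of consecutive inner products. -/
@[simp] lemma pairProd_nil : pairProd ([] : List E) = 1 := rfl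
/-- A single entry has no consecutive pair: product `1`. -/
@[simp] lemma pairProd_single (x : E) : pairProd [x] = 1 := rfl
/-- Unfolding `pairProd` at its first pair. -/
@[simp] lemma pairProd_cons_cons (x y : E) (r : List E) :
    pairProd (x :: y :: r) = ⟪x, y⟫ * pairProd (y :: r) := rfl
/-- `pairProd (a :: t ++ [w])` splits off the first link `⟪a, t.headD w⟫`. -/
lemma pairProd_cons_append_single (a : E) (t : List E) (w : E) :
    pairProd (a :: (t ++ [w])) = ⟪a, t.headD w⟫ * pairProd (t ++ [w]) := by
  cases t with
  | nil => simp
  | cons b t' => simp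

/-- The chain applied to a multiple of `w` is a multiple of its first projector's vector, with the
coefficient picking up one inner product per link. -/
lemma chain_smul (t : List E) (s : ℂ) (w : E) :
    chain t (s • w) = (s * pairProd (t ++ [w])) • t.headD w := by
  induction t with
  | nil => simp
  | cons a t ih =>
      rw [List.cons_append, chain_cons, ih, pairProd_cons_append_single, List.headD_cons]
      simp only [rproj, inner_smul_right]
      ring_nf

/-- **Pancharatnam / Bargmann product identity.**  For any vectors `ψ₀`, `t = [ψ₁, …, ψ_{K-1}]` and `c`,
`⟪c, Π₀ Π₁ ⋯ Π_{K-1} Π₀ c⟫ = ⟪ψ₀, c⟫ · conj ⟪ψ₀, c⟫ · ∏_{k} ⟪ψ_k, ψ_{k+1}⟫` (indices cyclic, `ψ_K = ψ₀`),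
where `Π_k = rproj ψ_k`. -/
theorem pancharatnam_product (ψ₀ : E) (t : List E) (c : E) :
    ⟪c, rproj ψ₀ (chain t (rproj ψ₀ c))⟫ =
      ⟪ψ₀, c⟫ * conj ⟪ψ₀, c⟫ * pairProd (ψ₀ :: (t ++ [ψ₀])) := by
  rw [show rproj ψ₀ c = ⟪ψ₀, c⟫ • ψ₀ from rfl, chain_smul, pairProd_cons_append_single]
  simp only [rproj, inner_smul_right]
  rw [← inner_conj_symm c ψ₀]
  ring

/-- The same identity with the squared modulus made explicit: the prefactor is `‖⟪ψ₀, c⟫‖²`, a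
nonnegative real, so the ARGUMENT of the matrix element is that of the cyclic product alone. -/
theorem pancharatnam_product' (ψ₀ : E) (t : List E) (c : E) :
    ⟪c, rproj ψ₀ (chain t (rproj ψ₀ c))⟫ =
      ((‖⟪ψ₀, c⟫‖ ^ 2 : ℝ) : ℂ) * pairProd (ψ₀ :: (t ++ [ψ₀])) := by
  rw [pancharatnam_product, Complex.mul_conj, Complex.normSq_eq_norm_sq]

/-- Two-point sanity instance (`K = 2`, `t = [ψ₁]`):
`⟪c, Π₀ Π₁ Π₀ c⟫ = ⟪ψ₀,c⟫ conj⟪ψ₀,c⟫ ⟪ψ₀,ψ₁⟫ ⟪ψ₁,ψ₀⟫`. -/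
example (ψ₀ ψ₁ c : E) :
    ⟪c, rproj ψ₀ (chain [ψ₁] (rproj ψ₀ c))⟫ =
      ⟪ψ₀, c⟫ * conj ⟪ψ₀, c⟫ * (⟪ψ₀, ψ₁⟫ * (⟪ψ₁, ψ₀⟫ * 1)) := by
  simpa using pancharatnam_product ψ₀ [ψ₁] c

end Summit.QuantumAdvantage.Dequantization.PancharatnamProduct
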